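import Summits.QuantumFields.BalabanUV.Beta.GAN24.RowV0Table
import Summits.QuantumFields.BalabanUV.Beta.GAN24.TaylorMassVHAn1At

/-!
# Road S3, birth-`0` V table for an1's SYMMETRISED border: `pushSum Lc (Lc^k) (symVhSAt (toSite r) d Lc κ″ u)` — masses, sizes, supports (twin of `RowV0TableSymAt`)

NOT IN PRINT — OUR BOOKKEEPING (road-P2 = `b2b-balaban-gan24-p2` gen 56, 2026-08-25; row G-an2-4 ∕ (CONV-C), the (α-0) chain at row D1's literal
OF RECORD (III′) `JsB12CombShSym`; [folklore] composition BY NAME; 0 `def`, 0 cite, 0 `def … : Prop`, 0 `sorry`).  Weight 0.  NEVER «G-an2-4 closed» as (CONV-C);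
NOT D1, NOT BetaPertH, NOT continuum, NOT Clay; NO campaign opened (an2 W-4) — a brick of the located `hUv⁰` transfer (road-P2 MEMO M-gan24p2-g56-1 §2(b) with M.77's
RAW-table socket `CombBornBorderLettersRaw`).

NAMING: in this package «Sym» in the ROOTED file names (`…SymAt`) means the UN-NEGATED rooted border `vhSAt ρ` (the OWNER's W15), while «An1» (these files) means an1's
(0.4)-SYMMETRISED border table `SymAveragingHessianCounts.symVhSAt ρ` — the type of the record field `SymTables.V`.  METHOD = the OWNER gan24-p1's gen-6 `mkroot.py` rule
(road-P2's `tools/mkstab.py`): the ROOTED file VERBATIM with `vhSAt (toSite r) ↦ symVhSAt (toSite r)`, asym's `SpineRooted.borderIncAt ↦ TaylorMassVHAn1At.symBorderIncAt`, an1's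
rooted support ∕ entry ∕ locality lemmas ↦ his SYMMETRISED ones (`symVhKerAt_eq_zero_left ∕ _right`, `abs_symVhKerAt_le ≤ 3ℓ²` «the SAME constant as the comb's», `locStencil_symVhSAt`,
block accessors by `packVH`); every ROOT-FREE lemma of the base modules BY NAME (not re-declared); same theorem names in the `…An1At` namespaces; base and rooted modules untouched;
zero-root bridges dropped (no root-0 base twin for the sym table).  Discharges NOTHING of (hS, hSall) ∕ hB by itself.
-/

noncomputable section

open Finset
open scoped BigOperators
open Literature.MathematicalPhysics.QuantumFieldTheory
open Literature.MathematicalPhysics.QuantumFieldTheory.Balaban1983to89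
open Literature.MathematicalPhysics.QuantumFieldTheory.Balaban1983to89.Beta
open Literature.Probability.LatticeModels (Torus.proj)
open LatticeForm (quo)
open B12Sec2to5 (l1 l1_nonneg)
open ExpKernelCalculus (MKer l1_natSmul l1_sub_triangle l1_sub_symm)
open OneStepResolventKernel (Fib eq_zsmul_quo_of_proj quo_zsmul proj_zsmul)
open OneStepKernelFamily (LegIdx legSet legPt l1_legPt_sub_le)
open AffineAveraging (box toSite)
open AveragingHessianKernels (ell)
open Summit.QuantumFields.BalabanUV.Beta.SymAveragingHessianCounts (symVhSAt symVhKerAt symVhKerAt_eq_zero_left symVhKerAt_eq_zero_right abs_symVhKerAt_le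
  locStencil_symVhSAt symVhSAt_symm)
open BalabanCompositeJets (pushSum)
open Summit.QuantumFields.BalabanUV.Beta.GAN24.TaylorBlockSum (l1_quo_sub_quo_le)
open Summit.QuantumFields.BalabanUV.Beta.GAN24.TaylorMassLam (card_filter_l1_le)
open Summit.QuantumFields.BalabanUV.Beta.GAN24.TaylorMassVHAn1At (abs_vhSAt_le vhSAt_ne_zero)
open Summit.QuantumFields.BalabanUV.Beta.GAN24.TaylorMassVHPush (pushSum_inl_inr_coarse_sum pushSum_inr_inl_coarse_sum
  sum_abs_pushSum_inl_inr_le sum_abs_pushSum_inr_inl_le)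
open Summit.QuantumFields.BalabanUV.Beta.GAN24.PushSumNest (pushSum_inr_of_proj_ne pushSum_inr_of_proj_ne')
open Summit.QuantumFields.BalabanUV.Beta.GAN24.RowV0Table (cast_R₀ cast_le_pow_succ l1_scaled_legPt_sub_le)

namespace Summit.QuantumFields.BalabanUV.Beta.GAN24.RowV0TableSymAn1At

variable {d : ℕ} {Lc : ℕ} {r : Fin (d + 1) → ℕ}

/-! ## §1 The multiplier-leg mass of the one-step (V-H) table at a fixed field site -/

/-- [folklore] MASS, multiplier leg FIRST (`(inr μ, inl α)` block): over any finite set of first arguments, at a fixed field site `y`,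
`Σ_{z∈Z} |symVhSAt ρ d Lc κ″ u z y (inr μ) (inl α)| ≤ (2R₀+1)^{d+1}·3ℓ²`. -/
theorem mass_mf_le (hL : 1 ≤ Lc) (hr : r ∈ box (d + 1) Lc) (κ'' : Fin (d + 1)) (u y : Fin (d + 1) → ℤ) (μ α : Fin (d + 1)) (Z : Finset (Fin (d + 1) → ℤ)) :
    ∑ z ∈ Z, |symVhSAt (toSite r) d Lc rfl κ'' u z y (Sum.inr μ) (Sum.inl α)|
      ≤ ((2 * (2 * (d + 1) * Lc) + 1 : ℕ) : ℝ) ^ (d + 1) * (3 * (ell (d + 1) Lc : ℝ) ^ 2) := by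
  classical
  set p : (Fin (d + 1) → ℤ) → Prop := fun z => l1 (z - u) ≤ ((2 * (d + 1) * Lc : ℕ) : ℝ) with hp
  rw [← Finset.sum_filter_add_sum_filter_not Z p]
  have hvan : ∑ z ∈ Z.filter (fun z => ¬ p z), |symVhSAt (toSite r) d Lc rfl κ'' u z y (Sum.inr μ) (Sum.inl α)| = 0 := by
    refine Finset.sum_eq_zero fun z hz => ?_
    rw [Finset.mem_filter] at hz
    rw [abs_eq_zero]
    by_contra hne
    have h := (vhSAt_ne_zero hL hr hne).1
    exact hz.2 (by rw [hp]; dsimp only; rw [cast_R₀]; exact h)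
  rw [hvan, add_zero]
  calc ∑ z ∈ Z.filter p, |symVhSAt (toSite r) d Lc rfl κ'' u z y (Sum.inr μ) (Sum.inl α)|
      ≤ ∑ _z ∈ Z.filter p, 3 * (ell (d + 1) Lc : ℝ) ^ 2 :=
        Finset.sum_le_sum fun z _ => abs_vhSAt_le hL hr _ _ _ _ _ _
    _ = ((Z.filter p).card : ℝ) * (3 * (ell (d + 1) Lc : ℝ) ^ 2) := by rw [Finset.sum_const, nsmul_eq_mul]
    _ ≤ _ := by
        refine mul_le_mul_of_nonneg_right ?_ (by positivity)
        exact_mod_cast card_filter_l1_le Z u (2 * (d + 1) * Lc)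

/-- [folklore] MASS, multiplier leg SECOND (`(inl α, inr μ)` block): at a fixed field site `w`,
`Σ_{z∈Z} |symVhSAt ρ d Lc κ″ u w z (inl α) (inr μ)| ≤ (2R₀+1)^{d+1}·3ℓ²`. -/
theorem mass_fm_le (hL : 1 ≤ Lc) (hr : r ∈ box (d + 1) Lc) (κ'' : Fin (d + 1)) (u w : Fin (d + 1) → ℤ) (α μ : Fin (d + 1)) (Z : Finset (Fin (d + 1) → ℤ)) :
    ∑ z ∈ Z, |symVhSAt (toSite r) d Lc rfl κ'' u w z (Sum.inl α) (Sum.inr μ)|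
      ≤ ((2 * (2 * (d + 1) * Lc) + 1 : ℕ) : ℝ) ^ (d + 1) * (3 * (ell (d + 1) Lc : ℝ) ^ 2) := by
  classical
  set p : (Fin (d + 1) → ℤ) → Prop := fun z => l1 (z - u) ≤ ((2 * (d + 1) * Lc : ℕ) : ℝ) with hp
  rw [← Finset.sum_filter_add_sum_filter_not Z p]
  have hvan : ∑ z ∈ Z.filter (fun z => ¬ p z), |symVhSAt (toSite r) d Lc rfl κ'' u w z (Sum.inl α) (Sum.inr μ)| = 0 := by
    refine Finset.sum_eq_zero fun z hz => ?_
    rw [Finset.mem_filter] at hz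
    rw [abs_eq_zero]
    by_contra hne
    have h := (vhSAt_ne_zero hL hr hne).2.1
    exact hz.2 (by rw [hp]; dsimp only; rw [cast_R₀]; exact h)
  rw [hvan, add_zero]
  calc ∑ z ∈ Z.filter p, |symVhSAt (toSite r) d Lc rfl κ'' u w z (Sum.inl α) (Sum.inr μ)|
      ≤ ∑ _z ∈ Z.filter p, 3 * (ell (d + 1) Lc : ℝ) ^ 2 :=
        Finset.sum_le_sum fun z _ => abs_vhSAt_le hL hr _ _ _ _ _ _
    _ = ((Z.filter p).card : ℝ) * (3 * (ell (d + 1) Lc : ℝ) ^ 2) := by rw [Finset.sum_const, nsmul_eq_mul]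
    _ ≤ _ := by
        refine mul_le_mul_of_nonneg_right ?_ (by positivity)
        exact_mod_cast card_filter_l1_le Z u (2 * (d + 1) * Lc)

/-! ## §2 Pointwise size of the pushed table: push multiplicity `Lc^k` -/

/-- [folklore] **SIZE, mf block**: `|pushSum Lc (Lc^k) (symVhSAt ρ d Lc κ″ u) w y (inr l) (inl l′)| ≤ Lc^k · (2R₀+1)^{d+1}·3ℓ²`. -/
theorem table_bd_mf [NeZero Lc] (hL : 1 ≤ Lc) (hr : r ∈ box (d + 1) Lc) (k : ℕ) (κ'' : Fin (d + 1)) (u w y : Fin (d + 1) → ℤ) (l l' : Fin (d + 1)) :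
    |pushSum Lc (Lc ^ k) (symVhSAt (toSite r) d Lc rfl κ'' u) w y (Sum.inr l) (Sum.inl l')|
      ≤ ((Lc : ℝ) ^ k) * (((2 * (2 * (d + 1) * Lc) + 1 : ℕ) : ℝ) ^ (d + 1) * (3 * (ell (d + 1) Lc : ℝ) ^ 2)) := by
  haveI : NeZero (Lc ^ k) := ⟨pow_ne_zero _ (NeZero.ne Lc)⟩
  have h := sum_abs_pushSum_inr_inl_le Lc (Lc ^ k) (symVhSAt (toSite r) d Lc rfl κ'' u) y l l' (mass_mf_le hL hr κ'' u y l l') {w}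
  rw [Finset.sum_singleton] at h
  simpa only [Nat.cast_pow] using h

/-- [folklore] **SIZE, fm block**: `|pushSum Lc (Lc^k) (symVhSAt ρ d Lc κ″ u) w y (inl l) (inr l′)| ≤ Lc^k · (2R₀+1)^{d+1}·3ℓ²`. -/
theorem table_bd_fm [NeZero Lc] (hL : 1 ≤ Lc) (hr : r ∈ box (d + 1) Lc) (k : ℕ) (κ'' : Fin (d + 1)) (u w y : Fin (d + 1) → ℤ) (l l' : Fin (d + 1)) :
    |pushSum Lc (Lc ^ k) (symVhSAt (toSite r) d Lc rfl κ'' u) w y (Sum.inl l) (Sum.inr l')|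
      ≤ ((Lc : ℝ) ^ k) * (((2 * (2 * (d + 1) * Lc) + 1 : ℕ) : ℝ) ^ (d + 1) * (3 * (ell (d + 1) Lc : ℝ) ^ 2)) := by
  haveI : NeZero (Lc ^ k) := ⟨pow_ne_zero _ (NeZero.ne Lc)⟩
  have h := sum_abs_pushSum_inl_inr_le Lc (Lc ^ k) (symVhSAt (toSite r) d Lc rfl κ'' u) w l l' (mass_fm_le hL hr κ'' u w l l') {y}
  rw [Finset.sum_singleton] at h
  simpa only [Nat.cast_pow] using h

/-! ## §3 Support of the pushed table relative to the vertex location -/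

/-- [folklore] **SUPPORT, mf block**: if `pushSum Lc (Lc^k) (symVhSAt ρ d Lc κ″ u) w y (inr l) (inl l′) ≠ 0` then the field leg `y` is
within `R₀ = 2(d+1)Lc` of `u` and the pushed multiplier leg `w` is a level-`N` coarse point within `7(d+1)` blocks of the block of `y`
(`N = Lc^{k+1}`). -/
theorem table_supp_mf (hL : 1 ≤ Lc) (hr : r ∈ box (d + 1) Lc) (k : ℕ) (κ'' : Fin (d + 1)) (u w y : Fin (d + 1) → ℤ) (l l' : Fin (d + 1))
    (h : pushSum Lc (Lc ^ k) (symVhSAt (toSite r) d Lc rfl κ'' u) w y (Sum.inr l) (Sum.inl l') ≠ 0) :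
    l1 (u - y) ≤ ((2 * (d + 1) * Lc : ℕ) : ℝ) ∧
      l1 (quo (Lc ^ (k + 1)) w - quo (Lc ^ (k + 1)) y) ≤ ((7 * (d + 1) : ℕ) : ℝ) := by
  have hN : Lc * Lc ^ k = Lc ^ (k + 1) := (pow_succ' Lc k).symm
  haveI : NeZero Lc := ⟨by omega⟩
  haveI : NeZero (Lc ^ k) := ⟨pow_ne_zero _ (by omega)⟩
  haveI : NeZero (Lc * Lc ^ k) := ⟨by rw [hN]; exact pow_ne_zero _ (by omega)⟩
  -- the pushed multiplier leg lives on the new coarse lattice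
  have hproj : Torus.proj (Lc * Lc ^ k) w = 0 := by
    by_contra hne
    exact h (pushSum_inr_of_proj_ne Lc (Lc ^ k) hne _ _ _ _)
  set w₁ := quo (Lc * Lc ^ k) w with hw₁
  have hw : w = ((Lc * Lc ^ k : ℕ) : ℤ) • w₁ := eq_zsmul_quo_of_proj hproj
  rw [hw, pushSum_inr_inl_coarse_sum] at h
  obtain ⟨i, hi, hne⟩ := Finset.exists_ne_zero_of_sum_ne_zero h
  have hv : symVhSAt (toSite r) d Lc rfl κ'' u ((Lc : ℤ) • legPt (Lc ^ k) (Sum.inl l : Fib d) w₁ i) y (Sum.inr l) (Sum.inl l') ≠ 0 := hne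
  obtain ⟨hX, hZ, -⟩ := vhSAt_ne_zero hL hr hv
  refine ⟨?_, ?_⟩
  · rw [l1_sub_symm, cast_R₀]; exact hZ
  · -- distance of the coarse point N•w₁ to y, then quo's Lipschitz bound
    set X := (Lc : ℤ) • legPt (Lc ^ k) (Sum.inl l : Fib d) w₁ i with hXdef
    set Nr : ℝ := (Lc : ℝ) * (Lc : ℝ) ^ k with hNr
    have hNcast : (((Lc * Lc ^ k : ℕ)) : ℝ) = Nr := by rw [hNr]; push_cast; ring
    have hNcast' : (((Lc ^ (k + 1) : ℕ)) : ℝ) = Nr := by rw [← hN]; exact hNcast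
    have hLN : (Lc : ℝ) ≤ Nr := by rw [hNr, ← pow_succ']; exact cast_le_pow_succ hL k
    have hNpos : (0 : ℝ) < Nr := by
      have : (0 : ℝ) < Lc := by exact_mod_cast (show 0 < Lc by omega)
      rw [hNr]; positivity
    have h1 : l1 (X - ((Lc * Lc ^ k : ℕ) : ℤ) • w₁) ≤ 2 * ((d : ℝ) + 1) * Nr := l1_scaled_legPt_sub_le k l w₁ hi
    have h2 : l1 (((Lc * Lc ^ k : ℕ) : ℤ) • w₁ - y) ≤ 6 * ((d : ℝ) + 1) * Nr := by
      have t1 := l1_sub_triangle (((Lc * Lc ^ k : ℕ) : ℤ) • w₁) X y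
      have t2 := l1_sub_triangle X u y
      rw [l1_sub_symm (((Lc * Lc ^ k : ℕ) : ℤ) • w₁) X] at t1
      rw [l1_sub_symm y u] at hZ
      have hd : (0 : ℝ) ≤ (d : ℝ) + 1 := by positivity
      nlinarith [mul_le_mul_of_nonneg_left hLN hd]
    have h3 := l1_quo_sub_quo_le (N := Lc * Lc ^ k) (((Lc * Lc ^ k : ℕ) : ℤ) • w₁) y
    rw [quo_zsmul] at h3
    have h4 : l1 (((Lc * Lc ^ k : ℕ) : ℤ) • w₁ - y) / (((Lc * Lc ^ k : ℕ)) : ℝ) ≤ 6 * ((d : ℝ) + 1) := by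
      rw [hNcast, div_le_iff₀ hNpos]; exact h2
    have hq : quo (Lc ^ (k + 1)) w = w₁ := by rw [hw, ← hN, quo_zsmul]
    rw [hq, ← hN]
    calc l1 (w₁ - quo (Lc * Lc ^ k) y) ≤ l1 (((Lc * Lc ^ k : ℕ) : ℤ) • w₁ - y) / (((Lc * Lc ^ k : ℕ)) : ℝ) + ((d + 1 : ℕ) : ℝ) := h3
      _ ≤ 6 * ((d : ℝ) + 1) + ((d + 1 : ℕ) : ℝ) := by linarith
      _ = ((7 * (d + 1) : ℕ) : ℝ) := by push_cast; ring

/-- [folklore] **SUPPORT, fm block**: if `pushSum Lc (Lc^k) (symVhSAt ρ d Lc κ″ u) w y (inl l) (inr l′) ≠ 0` then the field leg `w` is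
within `R₀ = 2(d+1)Lc` of `u` and the block of `u` is within `7(d+1)` blocks of the level-`N` coarse point `y`. -/
theorem table_supp_fm (hL : 1 ≤ Lc) (hr : r ∈ box (d + 1) Lc) (k : ℕ) (κ'' : Fin (d + 1)) (u w y : Fin (d + 1) → ℤ) (l l' : Fin (d + 1))
    (h : pushSum Lc (Lc ^ k) (symVhSAt (toSite r) d Lc rfl κ'' u) w y (Sum.inl l) (Sum.inr l') ≠ 0) :
    l1 (u - w) ≤ ((2 * (d + 1) * Lc : ℕ) : ℝ) ∧
      l1 (quo (Lc ^ (k + 1)) u - quo (Lc ^ (k + 1)) y) ≤ ((7 * (d + 1) : ℕ) : ℝ) := by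
  have hN : Lc * Lc ^ k = Lc ^ (k + 1) := (pow_succ' Lc k).symm
  haveI : NeZero Lc := ⟨by omega⟩
  haveI : NeZero (Lc ^ k) := ⟨pow_ne_zero _ (by omega)⟩
  haveI : NeZero (Lc * Lc ^ k) := ⟨by rw [hN]; exact pow_ne_zero _ (by omega)⟩
  have hproj : Torus.proj (Lc * Lc ^ k) y = 0 := by
    by_contra hne
    exact h (pushSum_inr_of_proj_ne' Lc (Lc ^ k) hne _ _ _ _)
  set y₁ := quo (Lc * Lc ^ k) y with hy₁
  have hy : y = ((Lc * Lc ^ k : ℕ) : ℤ) • y₁ := eq_zsmul_quo_of_proj hproj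
  rw [hy, pushSum_inl_inr_coarse_sum] at h
  obtain ⟨i, hi, hne⟩ := Finset.exists_ne_zero_of_sum_ne_zero h
  have hv : symVhSAt (toSite r) d Lc rfl κ'' u w ((Lc : ℤ) • legPt (Lc ^ k) (Sum.inl l' : Fib d) y₁ i) (Sum.inl l) (Sum.inr l') ≠ 0 := hne
  obtain ⟨hX, hZ, -⟩ := vhSAt_ne_zero hL hr hv
  refine ⟨?_, ?_⟩
  · rw [l1_sub_symm, cast_R₀]; exact hX
  · set Y := (Lc : ℤ) • legPt (Lc ^ k) (Sum.inl l' : Fib d) y₁ i with hYdef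
    set Nr : ℝ := (Lc : ℝ) * (Lc : ℝ) ^ k with hNr
    have hNcast : (((Lc * Lc ^ k : ℕ)) : ℝ) = Nr := by rw [hNr]; push_cast; ring
    have hLN : (Lc : ℝ) ≤ Nr := by rw [hNr, ← pow_succ']; exact cast_le_pow_succ hL k
    have hNpos : (0 : ℝ) < Nr := by
      have : (0 : ℝ) < Lc := by exact_mod_cast (show 0 < Lc by omega)
      rw [hNr]; positivity
    have h1 : l1 (Y - ((Lc * Lc ^ k : ℕ) : ℤ) • y₁) ≤ 2 * ((d : ℝ) + 1) * Nr := l1_scaled_legPt_sub_le k l' y₁ hi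
    have h2 : l1 (u - ((Lc * Lc ^ k : ℕ) : ℤ) • y₁) ≤ 4 * ((d : ℝ) + 1) * Nr := by
      have t1 := l1_sub_triangle u Y (((Lc * Lc ^ k : ℕ) : ℤ) • y₁)
      rw [l1_sub_symm u Y] at t1
      have hd : (0 : ℝ) ≤ (d : ℝ) + 1 := by positivity
      nlinarith [mul_le_mul_of_nonneg_left hLN hd]
    have h3 := l1_quo_sub_quo_le (N := Lc * Lc ^ k) u (((Lc * Lc ^ k : ℕ) : ℤ) • y₁)
    rw [quo_zsmul] at h3
    have h4 : l1 (u - ((Lc * Lc ^ k : ℕ) : ℤ) • y₁) / (((Lc * Lc ^ k : ℕ)) : ℝ) ≤ 4 * ((d : ℝ) + 1) := by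
      rw [hNcast, div_le_iff₀ hNpos]; exact h2
    have hq : quo (Lc ^ (k + 1)) y = y₁ := by rw [hy, ← hN, quo_zsmul]
    rw [hq, ← hN]
    calc l1 (quo (Lc * Lc ^ k) u - y₁) ≤ l1 (u - ((Lc * Lc ^ k : ℕ) : ℤ) • y₁) / (((Lc * Lc ^ k : ℕ)) : ℝ) + ((d + 1 : ℕ) : ℝ) := h3
      _ ≤ 4 * ((d : ℝ) + 1) + ((d + 1 : ℕ) : ℝ) := by linarith
      _ ≤ ((7 * (d + 1) : ℕ) : ℝ) := by push_cast; nlinarith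

/-! ## §4 The same facts in the currency of the engine of record `GAN24/TaylorVHSandwich` (both legs within `R = 8(d+1)·N` FINE units of the
vertex location; TWO-LEG mass per vertex location `≤ Lc^k·(2R₀+1)^{2(d+1)}·3ℓ²`) -/

/-- [folklore] **FINE SUPPORT, mf block**: both legs of a nonzero entry lie within `8(d+1)·Lc^{k+1}` of the vertex location `u`. -/
theorem table_suppR_mf (hL : 1 ≤ Lc) (hr : r ∈ box (d + 1) Lc) (k : ℕ) (κ'' : Fin (d + 1)) (u w y : Fin (d + 1) → ℤ) (l l' : Fin (d + 1))
    (h : pushSum Lc (Lc ^ k) (symVhSAt (toSite r) d Lc rfl κ'' u) w y (Sum.inr l) (Sum.inl l') ≠ 0) :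
    l1 (w - u) ≤ ((8 * (d + 1) * Lc ^ (k + 1) : ℕ) : ℝ) ∧ l1 (y - u) ≤ ((8 * (d + 1) * Lc ^ (k + 1) : ℕ) : ℝ) := by
  have hN : Lc * Lc ^ k = Lc ^ (k + 1) := (pow_succ' Lc k).symm
  haveI : NeZero Lc := ⟨by omega⟩
  haveI : NeZero (Lc ^ k) := ⟨pow_ne_zero _ (by omega)⟩
  haveI : NeZero (Lc * Lc ^ k) := ⟨by rw [hN]; exact pow_ne_zero _ (by omega)⟩
  have hproj : Torus.proj (Lc * Lc ^ k) w = 0 := by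
    by_contra hne
    exact h (pushSum_inr_of_proj_ne Lc (Lc ^ k) hne _ _ _ _)
  set w₁ := quo (Lc * Lc ^ k) w with hw₁
  have hw : w = ((Lc * Lc ^ k : ℕ) : ℤ) • w₁ := eq_zsmul_quo_of_proj hproj
  have h' := h
  rw [hw, pushSum_inr_inl_coarse_sum] at h'
  obtain ⟨i, hi, hne⟩ := Finset.exists_ne_zero_of_sum_ne_zero h'
  have hv : symVhSAt (toSite r) d Lc rfl κ'' u ((Lc : ℤ) • legPt (Lc ^ k) (Sum.inl l : Fib d) w₁ i) y (Sum.inr l) (Sum.inl l') ≠ 0 := hne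
  obtain ⟨hX, hZ, -⟩ := vhSAt_ne_zero hL hr hv
  set X := (Lc : ℤ) • legPt (Lc ^ k) (Sum.inl l : Fib d) w₁ i with hXdef
  set Nr : ℝ := (Lc : ℝ) * (Lc : ℝ) ^ k with hNr
  have hNcast : (((Lc ^ (k + 1) : ℕ)) : ℝ) = Nr := by rw [← hN, hNr]; push_cast; ring
  have hLN : (Lc : ℝ) ≤ Nr := by rw [hNr, ← pow_succ']; exact cast_le_pow_succ hL k
  have hd : (0 : ℝ) ≤ (d : ℝ) + 1 := by positivity
  have h1 : l1 (X - ((Lc * Lc ^ k : ℕ) : ℤ) • w₁) ≤ 2 * ((d : ℝ) + 1) * Nr := l1_scaled_legPt_sub_le k l w₁ hi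
  have hR : (((8 * (d + 1) * Lc ^ (k + 1) : ℕ)) : ℝ) = 8 * ((d : ℝ) + 1) * Nr := by rw [Nat.cast_mul, hNcast]; push_cast; ring
  rw [hR]
  have hLN' := mul_le_mul_of_nonneg_left hLN hd
  refine ⟨?_, ?_⟩
  · have t1 := l1_sub_triangle w X u
    have t2 := l1_sub_triangle w (((Lc * Lc ^ k : ℕ) : ℤ) • w₁) X
    have e0 : l1 (w - ((Lc * Lc ^ k : ℕ) : ℤ) • w₁) = 0 := by
      rw [hw, sub_self]; unfold l1; simp
    rw [l1_sub_symm (((Lc * Lc ^ k : ℕ) : ℤ) • w₁) X] at t2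
    nlinarith [l1_nonneg (X - u)]
  · nlinarith

/-- [folklore] **FINE SUPPORT, fm block**: both legs of a nonzero entry lie within `8(d+1)·Lc^{k+1}` of the vertex location `u`. -/
theorem table_suppR_fm (hL : 1 ≤ Lc) (hr : r ∈ box (d + 1) Lc) (k : ℕ) (κ'' : Fin (d + 1)) (u w y : Fin (d + 1) → ℤ) (l l' : Fin (d + 1))
    (h : pushSum Lc (Lc ^ k) (symVhSAt (toSite r) d Lc rfl κ'' u) w y (Sum.inl l) (Sum.inr l') ≠ 0) :
    l1 (w - u) ≤ ((8 * (d + 1) * Lc ^ (k + 1) : ℕ) : ℝ) ∧ l1 (y - u) ≤ ((8 * (d + 1) * Lc ^ (k + 1) : ℕ) : ℝ) := by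
  have hN : Lc * Lc ^ k = Lc ^ (k + 1) := (pow_succ' Lc k).symm
  haveI : NeZero Lc := ⟨by omega⟩
  haveI : NeZero (Lc ^ k) := ⟨pow_ne_zero _ (by omega)⟩
  haveI : NeZero (Lc * Lc ^ k) := ⟨by rw [hN]; exact pow_ne_zero _ (by omega)⟩
  have hproj : Torus.proj (Lc * Lc ^ k) y = 0 := by
    by_contra hne
    exact h (pushSum_inr_of_proj_ne' Lc (Lc ^ k) hne _ _ _ _)
  set y₁ := quo (Lc * Lc ^ k) y with hy₁
  have hy : y = ((Lc * Lc ^ k : ℕ) : ℤ) • y₁ := eq_zsmul_quo_of_proj hproj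
  have h' := h
  rw [hy, pushSum_inl_inr_coarse_sum] at h'
  obtain ⟨i, hi, hne⟩ := Finset.exists_ne_zero_of_sum_ne_zero h'
  have hv : symVhSAt (toSite r) d Lc rfl κ'' u w ((Lc : ℤ) • legPt (Lc ^ k) (Sum.inl l' : Fib d) y₁ i) (Sum.inl l) (Sum.inr l') ≠ 0 := hne
  obtain ⟨hX, hZ, -⟩ := vhSAt_ne_zero hL hr hv
  set Y := (Lc : ℤ) • legPt (Lc ^ k) (Sum.inl l' : Fib d) y₁ i with hYdef
  set Nr : ℝ := (Lc : ℝ) * (Lc : ℝ) ^ k with hNr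
  have hNcast : (((Lc ^ (k + 1) : ℕ)) : ℝ) = Nr := by rw [← hN, hNr]; push_cast; ring
  have hLN : (Lc : ℝ) ≤ Nr := by rw [hNr, ← pow_succ']; exact cast_le_pow_succ hL k
  have hd : (0 : ℝ) ≤ (d : ℝ) + 1 := by positivity
  have h1 : l1 (Y - ((Lc * Lc ^ k : ℕ) : ℤ) • y₁) ≤ 2 * ((d : ℝ) + 1) * Nr := l1_scaled_legPt_sub_le k l' y₁ hi
  have hR : (((8 * (d + 1) * Lc ^ (k + 1) : ℕ)) : ℝ) = 8 * ((d : ℝ) + 1) * Nr := by rw [Nat.cast_mul, hNcast]; push_cast; ring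
  rw [hR]
  have hLN' := mul_le_mul_of_nonneg_left hLN hd
  refine ⟨?_, ?_⟩
  · nlinarith
  · have t1 := l1_sub_triangle y Y u
    have t2 := l1_sub_triangle y (((Lc * Lc ^ k : ℕ) : ℤ) • y₁) Y
    have e0 : l1 (y - ((Lc * Lc ^ k : ℕ) : ℤ) • y₁) = 0 := by
      rw [hy, sub_self]; unfold l1; simp
    rw [l1_sub_symm (((Lc * Lc ^ k : ℕ) : ℤ) • y₁) Y] at t2
    nlinarith [l1_nonneg (Y - u)]

/-- [folklore] **TWO-LEG MASS, mf block**: over any finite sets of both legs, at a fixed vertex location,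
`Σ_{w∈S} Σ_{y∈T} |pushSum Lc (Lc^k) (symVhSAt ρ d Lc κ″ u) w y (inr l)(inl l′)| ≤ Lc^k·(2R₀+1)^{d+1}·((2R₀+1)^{d+1}·3ℓ²)`. -/
theorem table_mass2_mf [NeZero Lc] (hL : 1 ≤ Lc) (hr : r ∈ box (d + 1) Lc) (k : ℕ) (κ'' : Fin (d + 1)) (u : Fin (d + 1) → ℤ) (l l' : Fin (d + 1))
    (S T : Finset (Fin (d + 1) → ℤ)) :
    ∑ w ∈ S, ∑ y ∈ T, |pushSum Lc (Lc ^ k) (symVhSAt (toSite r) d Lc rfl κ'' u) w y (Sum.inr l) (Sum.inl l')|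
      ≤ ((Lc : ℝ) ^ k) * (((2 * (2 * (d + 1) * Lc) + 1 : ℕ) : ℝ) ^ (d + 1) *
          (((2 * (2 * (d + 1) * Lc) + 1 : ℕ) : ℝ) ^ (d + 1) * (3 * (ell (d + 1) Lc : ℝ) ^ 2))) := by
  classical
  haveI : NeZero (Lc ^ k) := ⟨pow_ne_zero _ (NeZero.ne Lc)⟩
  rw [Finset.sum_comm]
  set B₁ : ℝ := ((2 * (2 * (d + 1) * Lc) + 1 : ℕ) : ℝ) ^ (d + 1) * (3 * (ell (d + 1) Lc : ℝ) ^ 2) with hB₁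
  have hB₁0 : 0 ≤ B₁ := by positivity
  have hrow : ∀ y, ∑ w ∈ S, |pushSum Lc (Lc ^ k) (symVhSAt (toSite r) d Lc rfl κ'' u) w y (Sum.inr l) (Sum.inl l')| ≤ ((Lc ^ k : ℕ) : ℝ) * B₁ :=
    fun y => sum_abs_pushSum_inr_inl_le Lc (Lc ^ k) (symVhSAt (toSite r) d Lc rfl κ'' u) y l l' (mass_mf_le hL hr κ'' u y l l') S
  set p : (Fin (d + 1) → ℤ) → Prop := fun y => l1 (y - u) ≤ ((2 * (d + 1) * Lc : ℕ) : ℝ) with hp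
  rw [← Finset.sum_filter_add_sum_filter_not T p]
  have hvan : ∑ y ∈ T.filter (fun y => ¬ p y), ∑ w ∈ S, |pushSum Lc (Lc ^ k) (symVhSAt (toSite r) d Lc rfl κ'' u) w y (Sum.inr l) (Sum.inl l')| = 0 := by
    refine Finset.sum_eq_zero fun y hy => Finset.sum_eq_zero fun w _ => ?_
    rw [Finset.mem_filter] at hy
    rw [abs_eq_zero]
    by_contra hne
    have h1 := (table_supp_mf hL hr k κ'' u w y l l' hne).1
    rw [l1_sub_symm] at h1
    exact hy.2 h1
  rw [hvan, add_zero]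
  calc ∑ y ∈ T.filter p, ∑ w ∈ S, |pushSum Lc (Lc ^ k) (symVhSAt (toSite r) d Lc rfl κ'' u) w y (Sum.inr l) (Sum.inl l')|
      ≤ ∑ _y ∈ T.filter p, ((Lc ^ k : ℕ) : ℝ) * B₁ := Finset.sum_le_sum fun y _ => hrow y
    _ = ((T.filter p).card : ℝ) * (((Lc ^ k : ℕ) : ℝ) * B₁) := by rw [Finset.sum_const, nsmul_eq_mul]
    _ ≤ ((2 * (2 * (d + 1) * Lc) + 1 : ℕ) : ℝ) ^ (d + 1) * (((Lc ^ k : ℕ) : ℝ) * B₁) := by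
        refine mul_le_mul_of_nonneg_right ?_ (by positivity)
        exact_mod_cast card_filter_l1_le T u (2 * (d + 1) * Lc)
    _ = _ := by rw [hB₁]; push_cast; ring

/-- [folklore] **TWO-LEG MASS, fm block**: the same bound for the `(inl l, inr l′)` block. -/
theorem table_mass2_fm [NeZero Lc] (hL : 1 ≤ Lc) (hr : r ∈ box (d + 1) Lc) (k : ℕ) (κ'' : Fin (d + 1)) (u : Fin (d + 1) → ℤ) (l l' : Fin (d + 1))
    (S T : Finset (Fin (d + 1) → ℤ)) :
    ∑ w ∈ S, ∑ y ∈ T, |pushSum Lc (Lc ^ k) (symVhSAt (toSite r) d Lc rfl κ'' u) w y (Sum.inl l) (Sum.inr l')|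
      ≤ ((Lc : ℝ) ^ k) * (((2 * (2 * (d + 1) * Lc) + 1 : ℕ) : ℝ) ^ (d + 1) *
          (((2 * (2 * (d + 1) * Lc) + 1 : ℕ) : ℝ) ^ (d + 1) * (3 * (ell (d + 1) Lc : ℝ) ^ 2))) := by
  classical
  haveI : NeZero (Lc ^ k) := ⟨pow_ne_zero _ (NeZero.ne Lc)⟩
  set B₁ : ℝ := ((2 * (2 * (d + 1) * Lc) + 1 : ℕ) : ℝ) ^ (d + 1) * (3 * (ell (d + 1) Lc : ℝ) ^ 2) with hB₁
  have hB₁0 : 0 ≤ B₁ := by positivity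
  have hrow : ∀ w, ∑ y ∈ T, |pushSum Lc (Lc ^ k) (symVhSAt (toSite r) d Lc rfl κ'' u) w y (Sum.inl l) (Sum.inr l')| ≤ ((Lc ^ k : ℕ) : ℝ) * B₁ :=
    fun w => sum_abs_pushSum_inl_inr_le Lc (Lc ^ k) (symVhSAt (toSite r) d Lc rfl κ'' u) w l l' (mass_fm_le hL hr κ'' u w l l') T
  set p : (Fin (d + 1) → ℤ) → Prop := fun w => l1 (w - u) ≤ ((2 * (d + 1) * Lc : ℕ) : ℝ) with hp
  rw [← Finset.sum_filter_add_sum_filter_not S p]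
  have hvan : ∑ w ∈ S.filter (fun w => ¬ p w), ∑ y ∈ T, |pushSum Lc (Lc ^ k) (symVhSAt (toSite r) d Lc rfl κ'' u) w y (Sum.inl l) (Sum.inr l')| = 0 := by
    refine Finset.sum_eq_zero fun w hw => Finset.sum_eq_zero fun y _ => ?_
    rw [Finset.mem_filter] at hw
    rw [abs_eq_zero]
    by_contra hne
    have h1 := (table_supp_fm hL hr k κ'' u w y l l' hne).1
    rw [l1_sub_symm] at h1
    exact hw.2 h1
  rw [hvan, add_zero]
  calc ∑ w ∈ S.filter p, ∑ y ∈ T, |pushSum Lc (Lc ^ k) (symVhSAt (toSite r) d Lc rfl κ'' u) w y (Sum.inl l) (Sum.inr l')|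
      ≤ ∑ _w ∈ S.filter p, ((Lc ^ k : ℕ) : ℝ) * B₁ := Finset.sum_le_sum fun w _ => hrow w
    _ = ((S.filter p).card : ℝ) * (((Lc ^ k : ℕ) : ℝ) * B₁) := by rw [Finset.sum_const, nsmul_eq_mul]
    _ ≤ ((2 * (2 * (d + 1) * Lc) + 1 : ℕ) : ℝ) ^ (d + 1) * (((Lc ^ k : ℕ) : ℝ) * B₁) := by
        refine mul_le_mul_of_nonneg_right ?_ (by positivity)
        exact_mod_cast card_filter_l1_le S u (2 * (d + 1) * Lc)
    _ = _ := by rw [hB₁]; push_cast; ring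

end Summit.QuantumFields.BalabanUV.Beta.GAN24.RowV0TableSymAn1At

end
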